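import Summits.KontsevichZagierPeriods.KontsevichZagierPeriods.Theorems.UnfoldedStokesStokesGenerationStubBoxToCube
import Literature.NumberTheory.Transcendental.KZLogCalculusProofs
import Literature.NumberTheory.Transcendental.KZSemiCanonicalReductionProofs

/-!
# `CubeKernelStep` (stmt-KontsevichZagierPeriods-17854), line `Sketch`, stub `stub_ratBoxes` (rung)

HILBERT'S THIRD PROBLEM FOR RATIONAL BOXES INSIDE THE KZ RULES (the flat calibration of the birth
skeleton `solid_step` of the crux). Two integral representations with integrand `1` on closed
rational boxes `Π [aᵢ, bᵢ]`, `Π [a'ᵢ, b'ᵢ]` (`aᵢ ≤ bᵢ`, `a'ᵢ ≤ b'ᵢ`; degenerate boxes allowed) with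
the same value differ by a Kontsevich–Zagier relation.

Proof. The value of such a representation is the volume `Π (bᵢ − aᵢ)` of its box
(`KZ.IntegralRep.value_eq_volume_real`, `Real.volume_Icc_pi_toReal`). If this value is `0`, one
factor vanishes, the box lies in a coordinate hyperplane and is Lebesgue-null
(`Real.volume_Icc_pi`), so the representation itself is a relation
(`KZ.of_mem_relations_of_volume_eq_zero`, rule (1)); as the two values agree this settles every
degenerate case at once. Otherwise `aᵢ < bᵢ` and `a'ᵢ < b'ᵢ` for all `i`, and the landed affine
cubification `stub_boxToCube` (ONE rule-(2) move `x ↦ a + (b − a)·x`; rational corners are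
algebraic) makes each representation congruent to a closed-unit-cube representation whose
integrand is the CONSTANT `Π (bᵢ − aᵢ) = P.value`, resp. `Π (b'ᵢ − a'ᵢ) = Q.value`, on the cube
(the chart maps the cube into the box, `boxAff_image_cube`, where the integrand is `1`). These two
constants agree by hypothesis, so the two cube representations differ by a relation (congruence,
`KZ.of_sub_of_mem_relations_of_eqOn`), and
`[P] − [Q] = ([P] − [tP]) + ([tP] − [tQ]) − ([Q] − [tQ])`.
No definition is introduced and no transcendence enters; dimension `0` needs no separate treatment
(both boxes are the one-point space, of value `1`).

References: M. Kontsevich, D. Zagier, *Periods* (2001), §1.2 (rules (1), (2); Problem 1 and the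
discussion of Hilbert's third problem / scissors congruence).
-/

noncomputable section

set_option linter.dupNamespace false

namespace Summit.KontsevichZagierPeriods.KontsevichZagierPeriods.Cruxes.CubeKernelStep.Layers

open MeasureTheory Set
open Literature.NumberTheory.Transcendental
open Literature.NumberTheory.Transcendental.KZ
open Summit.KontsevichZagierPeriods.KontsevichZagierPeriods.Cruxes.StokesGeneration.FibrewiseStokes
  (stub_boxToCube boxAff_image_cube)

/-! ## Closed boxes with integrand `1` -/

/-- The Lebesgue measure of a closed box `Π [lᵢ, uᵢ]` is `Π (uᵢ − lᵢ)` (in `ℝ≥0∞`, truncated at `0`).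
[folklore] -/
theorem ratBoxes_volume_box {n : ℕ} (l u : Fin n → ℝ) :
    volume (Set.pi Set.univ (fun i => Set.Icc (l i) (u i))) = ∏ i, ENNReal.ofReal (u i - l i) := by
  rw [Set.pi_univ_Icc, Real.volume_Icc_pi]

/-- A representation with integrand `1` on a closed box `Π [lᵢ, uᵢ]`, `lᵢ ≤ uᵢ`, has value
`Π (uᵢ − lᵢ)` (the volume of the box). [folklore] -/
theorem ratBoxes_value_eq_prod {n : ℕ} (r : IntegralRep n) (l u : Fin n → ℝ) (hlu : ∀ i, l i ≤ u i)
    (hdom : r.domain = Set.pi Set.univ (fun i => Set.Icc (l i) (u i)))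
    (h1 : ∀ x ∈ r.domain, r.integrand x = 1) : r.value = ∏ i, (u i - l i) := by
  rw [IntegralRep.value_eq_volume_real r h1, measureReal_def, hdom, Set.pi_univ_Icc,
    Real.volume_Icc_pi_toReal (Pi.le_def.mpr hlu)]

/-- A representation with integrand `1` on a closed box `Π [lᵢ, uᵢ]`, `lᵢ ≤ uᵢ`, of value `0` is a
relation: one side of the box is degenerate, so the box is Lebesgue-null (rule (1), null domains).
[cite: KontsevichZagier2001, §1.2] -/
theorem ratBoxes_of_mem_relations_of_value_eq_zero {n : ℕ} (r : IntegralRep n) (l u : Fin n → ℝ)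
    (hlu : ∀ i, l i ≤ u i) (hdom : r.domain = Set.pi Set.univ (fun i => Set.Icc (l i) (u i)))
    (h1 : ∀ x ∈ r.domain, r.integrand x = 1) (h0 : r.value = 0) : of r ∈ relations := by
  rw [ratBoxes_value_eq_prod r l u hlu hdom h1, Finset.prod_eq_zero_iff] at h0
  obtain ⟨i, _, hi⟩ := h0
  refine of_mem_relations_of_volume_eq_zero r ?_
  rw [hdom, ratBoxes_volume_box]
  exact Finset.prod_eq_zero (Finset.mem_univ i) (by rw [hi, ENNReal.ofReal_zero])

/-- A representation with integrand `1` on a closed box `Π [lᵢ, uᵢ]`, `lᵢ ≤ uᵢ`, of non-zero value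
has a non-degenerate box: `lᵢ < uᵢ` for all `i`. [folklore] -/
theorem ratBoxes_lt_of_value_ne_zero {n : ℕ} (r : IntegralRep n) (l u : Fin n → ℝ)
    (hlu : ∀ i, l i ≤ u i) (hdom : r.domain = Set.pi Set.univ (fun i => Set.Icc (l i) (u i)))
    (h1 : ∀ x ∈ r.domain, r.integrand x = 1) (h0 : r.value ≠ 0) : ∀ i, l i < u i := by
  rw [ratBoxes_value_eq_prod r l u hlu hdom h1] at h0
  intro i
  have hi : u i - l i ≠ 0 := Finset.prod_ne_zero_iff.mp h0 i (Finset.mem_univ i)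
  exact lt_of_le_of_ne (hlu i) fun h => hi (by rw [h, sub_self])

/-! ## Cubification with constant integrand -/

/-- **Affine cubification of a non-degenerate box with integrand `1`** (the landed
`stub_boxToCube`, one rule-(2) move): a representation with integrand `1` on `Π [lᵢ, uᵢ]`,
`lᵢ < uᵢ` real algebraic, is congruent modulo the relations to a closed-unit-cube representation
whose integrand equals the constant `r.value = Π (uᵢ − lᵢ)` on the cube (the chart maps the cube
into the box, where the integrand is `1`). [cite: KontsevichZagier2001, §1.2 rule (2)] -/
theorem ratBoxes_exists_cube_const {n : ℕ} (r : IntegralRep n) (l u : Fin n → ℝ)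
    (hl : ∀ i, IsAlgebraic ℚ (l i)) (hu : ∀ i, IsAlgebraic ℚ (u i)) (hlu : ∀ i, l i < u i)
    (hdom : r.domain = Set.pi Set.univ (fun i => Set.Icc (l i) (u i)))
    (h1 : ∀ x ∈ r.domain, r.integrand x = 1) :
    ∃ t : IntegralRep n, t.domain = Set.pi Set.univ (fun _ : Fin n => Set.Icc (0:ℝ) 1) ∧
      (∀ x ∈ t.domain, t.integrand x = r.value) ∧ of r - of t ∈ relations := by
  obtain ⟨t, htd, hti, hrel⟩ := stub_boxToCube n l u r hl hu hlu hdom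
  refine ⟨t, htd, fun x hx => ?_, hrel⟩
  rw [htd] at hx
  have hmem : (fun i => l i + (u i - l i) * x i) ∈ r.domain := by
    rw [hdom, ← boxAff_image_cube hlu]
    exact mem_image_of_mem _ hx
  rw [hti x hx, h1 _ hmem, mul_one, ratBoxes_value_eq_prod r l u (fun i => (hlu i).le) hdom h1]

/-! ## The stub -/

/-- **Registered rung stub `stub_ratBoxes` (the birth skeleton `solid_step`'s flat calibration,
`IsRatBox` inlined): rational boxes of equal volume are KZ-equivalent.** Two representations with
integrand `1` on closed rational boxes `Π [aᵢ, bᵢ]`, `Π [a'ᵢ, b'ᵢ]` (possibly degenerate) of the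
same value differ by a relation: degenerate boxes are null (rule (1)); non-degenerate ones are
cubified by one affine rule-(2) move each (`stub_boxToCube`) to the closed unit cube with the
constant integrands `P.value = Q.value`, which are congruent. [cite: KontsevichZagier2001, §1.2] -/
theorem stub_ratBoxes :
    ∀ (n : ℕ) (P Q : IntegralRep n) (a b a' b' : Fin n → ℚ),
      (∀ i, a i ≤ b i) → (∀ i, a' i ≤ b' i) →
      P.domain = Set.pi Set.univ (fun i => Set.Icc ((a i : ℚ) : ℝ) (b i)) →
      Q.domain = Set.pi Set.univ (fun i => Set.Icc ((a' i : ℚ) : ℝ) (b' i)) →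
      (∀ x ∈ P.domain, P.integrand x = 1) → (∀ x ∈ Q.domain, Q.integrand x = 1) →
      P.value = Q.value → of P - of Q ∈ relations := by
  intro n P Q a b a' b' hab hab' hPd hQd hP1 hQ1 hPQ
  have habR : ∀ i, ((a i : ℚ) : ℝ) ≤ ((b i : ℚ) : ℝ) := fun i => Rat.cast_le.mpr (hab i)
  have habR' : ∀ i, ((a' i : ℚ) : ℝ) ≤ ((b' i : ℚ) : ℝ) := fun i => Rat.cast_le.mpr (hab' i)
  by_cases h0 : P.value = 0
  · -- both boxes are degenerate, hence null: both representations are relations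
    exact relations.sub_mem
      (ratBoxes_of_mem_relations_of_value_eq_zero P (fun i => (a i : ℝ)) (fun i => (b i : ℝ))
        habR hPd hP1 h0)
      (ratBoxes_of_mem_relations_of_value_eq_zero Q (fun i => (a' i : ℝ)) (fun i => (b' i : ℝ))
        habR' hQd hQ1 (hPQ.symm.trans h0))
  · -- both boxes are non-degenerate: cubify both and compare the two constants
    have hQ0 : Q.value ≠ 0 := fun h => h0 (hPQ.trans h)
    have hlt : ∀ i, ((a i : ℚ) : ℝ) < ((b i : ℚ) : ℝ) :=
      ratBoxes_lt_of_value_ne_zero P (fun i => (a i : ℝ)) (fun i => (b i : ℝ)) habR hPd hP1 h0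
    have hlt' : ∀ i, ((a' i : ℚ) : ℝ) < ((b' i : ℚ) : ℝ) :=
      ratBoxes_lt_of_value_ne_zero Q (fun i => (a' i : ℝ)) (fun i => (b' i : ℝ)) habR' hQd hQ1 hQ0
    obtain ⟨tP, htPd, htPi, hPrel⟩ :=
      ratBoxes_exists_cube_const P (fun i => (a i : ℝ)) (fun i => (b i : ℝ))
        (fun i => isAlgebraic_rat ℚ (a i)) (fun i => isAlgebraic_rat ℚ (b i))
        hlt hPd hP1
    obtain ⟨tQ, htQd, htQi, hQrel⟩ :=
      ratBoxes_exists_cube_const Q (fun i => (a' i : ℝ)) (fun i => (b' i : ℝ))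
        (fun i => isAlgebraic_rat ℚ (a' i)) (fun i => isAlgebraic_rat ℚ (b' i))
        hlt' hQd hQ1
    have hmid : of tP - of tQ ∈ relations :=
      of_sub_of_mem_relations_of_eqOn (htQd.trans htPd.symm) fun x hx => by
        have hx' : x ∈ tQ.domain := by
          rw [htQd, ← htPd]
          exact hx
        rw [htPi x hx, htQi x hx', hPQ]
    have hsplit : of P - of Q = (of P - of tP) + (of tP - of tQ) - (of Q - of tQ) := by abel
    rw [hsplit]
    exact relations.sub_mem (relations.add_mem hPrel hmid) hQrel

end Summit.KontsevichZagierPeriods.KontsevichZagierPeriods.Cruxes.CubeKernelStep.Layers
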